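import Mathlib
import HarnessLib
import Summits.HubbardSuperconductivity.HubbardSuperconductivity.Theorems.KLProgrammeKLRegimeEngineTowerBookkeepingProfileTok
import Summits.HubbardSuperconductivity.HubbardSuperconductivity.Theorems.KLProgrammeKLRegimeEngineTowerBlockIncrWtKitCarrier
import Summits.HubbardSuperconductivity.HubbardSuperconductivity.Theorems.KLProgrammeKLRegimeEngineTowerLevFloorUnitsDefs

/-!
# Route `KLProgramme` — crux K3 ENGINE (stmt-HubbardSuperconductivity-20437 `KLRegimeEngineV17F2`), stub (b) v2, THE WEIGHTED HALF «(b)-WT4»: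
# W1 — THE RE-BASED ONE-TRACK WEIGHTED TOWER LAW FROM NAMED INPUTS, TOKEN CARRIED, PROFILE ROWS EXPORTED
# (cell gate-hubbard-kl, seat hubbard-kl-k3c3-p2 g17; pen (R355)(A) register item «(b)-WT4»; weighted twin of …TowerLevLawBaseTokX §1 (M1-tokX) on the
#  rate-decoupled weighted arrays of …TowerModelDefsRate (E1 lead r2d-p2 g8); E1 may rename or supersede)

WHY.  Stub (b) concludes, at every level `j ≤ n`, BOTH `KernelNormsLevels … (K_n) j` (the (ℓ) chain, assembled in …TowerLevAssemblyKlEngFinal) AND the weighted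
clause `KernelNormsWt4 L M (klWtBudget P Q U j) β U μ (K_n) j` — the one-pinned, `klScaleWt_j`-weighted profile of `𝒱_j[K_n]` at `F_j` in every degree `m ≠ 2`.
Odd degrees vanish (…TowerParityUnits), degree `0` is vacuous, degree `2` is carved, degrees `4` and `6` are import cells (k3c2-p3's …TowerImportWt modulo E1's
weighted plain lines); the degrees `2p ≥ 8` are read off the blocked tower run ONCE PER READ-OUT LEVEL `j` with every weight at the target rate `Λ_j`
(E1-LEVELS-BLUEPRINT-g8 §8 (K4)).  THE WEIGHTED RUN IS ONE-TRACK: the one-pinned weighted re-measurement of a born increment across a family jump `J → J′`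
costs `C₁C₂^{2p−1}(2^{J′−J})^{2p−2}` (p4 g17's m-uniform row `klWtPinnedSumAt_klTowerIncr_remeasure_le_klEng_flow_all_uniform`, one leg saved by conservation)
against the unit ratio `2^{(3p−5)(J′−J)}` of the track-`0` floor unit `klLevUnitF β M 0 p ·` — a GAIN `(2^{J′−J})^{3−p}` in every degree `2p ≥ 8`, exactly marginal
at six legs; so with the six-leg MEASURED size an import at every block (as the `t = 0` six-leg cell is in (ℓ)) no all-known track, no narrow/wide split and no
absolute count is needed, and block `0` is dropped as in (ℓ) (base = `𝒱_d` read at `F_{d−1}` by p3's weighted grid step).  This file is the generic layer M1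
of that chain, an instance of the tokenised re-based kit `towerBorn_le_law_tracks_of_profile_base_tok` (…BookkeepingProfileTok §2) with ONE track:

* arrays (inline, no definitions): born `klTowerBornWtAt … d (k−1) j (2p) / klLevUnitF β M 0 p (d(k−1))` (block `k ≥ 1` ↦ `Δ_{k−1}` at `F_{d(k−1)}`, rate `j`),
  measured `W·Z^m·klTowerMeasWtAt … d k j (2m) / klLevUnitF β M 0 m (dk−1)` (input `𝒱_{dk}` at `F_{dk−1}`, rate `j`; `W, Z ≥ 0` the LINK's scalings);
* **`klTowerBornWtAt_le_law_of_inputs_base_tokX (j d Kb D)`** — NAMED inputs: the block-`1` measured profile `hbase` (degrees `8 ≤ 2m ≤ 2D`), the re-based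
  re-measurement BRIDGE `hR` at blocks `2 ≤ k ≤ K_b` (profile of `𝒱_{dk} = 𝒱_d + Σ_{1≤k′<k} Δ_{k′}` from the law on the born arrays of blocks `2 … k`), the three
  IMPORTS `ι₁ʷ ι₂ʷ ι₃ʷ` (degrees `2, 4, 6`) at every block `1 ≤ k ≤ K_b`, the token `Zk` (base `hZ1`, propagation `hZsucc` under the step's guard — «(ℓ)-Z-THREAD»
  discipline from the start), the weighted STEP at blocks `1 ≤ k < K_b` in the kit's literal form (W2 serves it), and the kit's numerics verbatim ⊢
  `(∀ k, 1 ≤ k ≤ K_b → Zk k) ∧ (∀ k, 2 ≤ k ≤ K_b, ∀ 3 ≤ p ≤ D, born ≤ Aλ^{p−1}Q^p) ∧ (∀ k, 1 ≤ k ≤ K_b, ∀ 4 ≤ m ≤ D, measured ≤ A′λ^{m−1}Q′^m)` — the last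
  conjunct EXPORTS the kit's Chernoff data of every block for the read-out of the partial increment (…TowerLevLawBaseTokX's reason, verbatim).
No model hypothesis is needed or assumed; the rate index `j`, the frame `K` and the block length `d` are free.
Composition of a landed theorem; nothing about the model is asserted; nothing asserts (b), (ℓ), any stub, K3 or superconductivity.
References: BGM 2006 §2.8 (2.83), (2.93)–(2.98), §3 (3.2)–(3.8) [cite: BenfattoGiulianiMastropietro2006].
-/

noncomputable section

namespace Summit.HubbardSuperconductivity.HubbardSuperconductivity.Theorems.EngineV8

set_option linter.dupNamespace false -- summit = problem name (single-conjunct summit), D-0017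

open Classical
open Real Finset Literature.MathematicalPhysics.QuantumLattice Literature.Probability.LatticeModels GrassmannAlgebra
open Literature.MathematicalPhysics.QuantumLattice.FermiRG
open Summit.HubbardSuperconductivity.HubbardSuperconductivity.Theorems.KLProgrammeLegKernels
open Summit.HubbardSuperconductivity.HubbardSuperconductivity.Theorems.KLRegimeSplit
open Summit.HubbardSuperconductivity.HubbardSuperconductivity.Theorems.DispersionFlow

variable {L M : ℕ} [NeZero L] [NeZero M]

/-! ## §1 Nonnegativity of the weighted arrays in units -/

/-- The measured weighted array in units, scaled by `W·Z^m ≥ 0`, is nonnegative (`0 < β`). -/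
theorem towerMuWt_nonneg {β : ℝ} (hβ : 0 < β) (U μ : ℝ) (K : TrigPolyC4v) (d k j m : ℕ) {W Z : ℝ} (hW : 0 ≤ W) (hZ : 0 ≤ Z) :
    0 ≤ W * Z ^ m * (klTowerMeasWtAt L M β U μ K d k j (2 * m) / klLevUnitF β M 0 m (d * k - 1)) :=
  mul_nonneg (by positivity) (div_nonneg (klTowerMeasWtAt_nonneg hβ.le U μ K d k j (2 * m)) (klLevUnitF_pos hβ 0 m (d * k - 1)).le)

/-- The born weighted array in units is nonnegative (`0 < β`). -/
theorem towerBWt_nonneg {β : ℝ} (hβ : 0 < β) (U μ : ℝ) (K : TrigPolyC4v) (d k j p : ℕ) :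
    0 ≤ klTowerBornWtAt L M β U μ K d k j (2 * p) / klLevUnitF β M 0 p (d * k) :=
  div_nonneg (klTowerBornWtAt_nonneg hβ.le U μ K d k j (2 * p)) (klLevUnitF_pos hβ 0 p (d * k)).le

/-! ## §2 W1: the re-based one-track weighted law from named inputs, token carried, profile rows exported -/

/-- **THE RE-BASED ONE-TRACK WEIGHTED TOWER LAW FROM NAMED INPUTS, TOKEN CARRIED, PROFILE ROWS EXPORTED** (weighted twin of
`klTowerBLevF_le_law_of_inputs_base_tokX`; rate index `j`, frame `K`, block length `d` free).  Arrays: born `klTowerBornWtAt … d (k−1) j (2p) / klLevUnitF β M 0 p (d(k−1))`,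
measured `W·Z^m·klTowerMeasWtAt … d k j (2m) / klLevUnitF β M 0 m (dk−1)`.  Given the block-`1` profile `hbase`, the re-measurement bridge `hR` at the blocks
`2 ≤ k ≤ K_b`, the imports `ι₁ ι₂ ι₃` (degrees `2, 4, 6`) at every block `1 ≤ k ≤ K_b`, the token (`hZ1`, `hZsucc`), the step at the blocks `1 ≤ k < K_b` and the
kit's numerics: the token holds at every block `1 ≤ k ≤ K_b`, the born arrays of the blocks `2 ≤ k ≤ K_b` obey `Aλ^{p−1}Q^p` (`3 ≤ p ≤ D`), and the measured
profile rows `≤ A′λ^{m−1}Q′^m` (`4 ≤ m ≤ D`) hold at every block `1 ≤ k ≤ K_b`. [cite: BenfattoGiulianiMastropietro2006, §2.8 (2.83), (2.93)-(2.98)] -/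
theorem klTowerBornWtAt_le_law_of_inputs_base_tokX {β : ℝ} (hβ : 0 < β) (U μ : ℝ) (K : TrigPolyC4v)
    (j d Kb D : ℕ) {A lam Q W Z A' Q' σ Φ ψ τ ι₁ ι₂ ι₃ : ℝ} {Zk : ℕ → Prop} (hD3 : 3 ≤ D)
    (hA : 0 ≤ A) (hlam : 0 < lam) (hQ : 0 ≤ Q) (hW : 0 ≤ W) (hZ : 0 ≤ Z) (hA'0 : 0 ≤ A') (hQ'0 : 0 < Q')
    (hσ : 0 ≤ σ) (hΦ : 0 ≤ Φ) (hψ : 0 ≤ ψ) (hτ : 0 < τ)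
    -- the base profile at block 1 (`𝒱_d` at `F_{d−1}`, rate `j`)
    (hbase : ∀ m, 4 ≤ m → m ≤ D →
      W * Z ^ m * (klTowerMeasWtAt L M β U μ K d 1 j (2 * m) / klLevUnitF β M 0 m (d * 1 - 1)) ≤ A' * lam ^ (m - 1) * Q' ^ m)
    -- the re-based re-measurement bridge at blocks 2 ≤ k ≤ Kb
    (hR : ∀ k, 2 ≤ k → k ≤ Kb →
      (∀ k', 2 ≤ k' → k' ≤ k → ∀ p, 3 ≤ p → p ≤ D →
        klTowerBornWtAt L M β U μ K d (k' - 1) j (2 * p) / klLevUnitF β M 0 p (d * (k' - 1)) ≤ A * lam ^ (p - 1) * Q ^ p) →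
      ∀ m, 4 ≤ m → m ≤ D →
        W * Z ^ m * (klTowerMeasWtAt L M β U μ K d k j (2 * m) / klLevUnitF β M 0 m (d * k - 1)) ≤ A' * lam ^ (m - 1) * Q' ^ m)
    -- the weighted imports (degrees 2, 4, 6) at every block 1 ≤ k ≤ Kb
    (hι₁ : ∀ k, 1 ≤ k → k ≤ Kb → W * Z ^ 1 * (klTowerMeasWtAt L M β U μ K d k j (2 * 1) / klLevUnitF β M 0 1 (d * k - 1)) ≤ ι₁ * lam)
    (hι₂ : ∀ k, 1 ≤ k → k ≤ Kb → W * Z ^ 2 * (klTowerMeasWtAt L M β U μ K d k j (2 * 2) / klLevUnitF β M 0 2 (d * k - 1)) ≤ ι₂ * lam)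
    (hι₃ : ∀ k, 1 ≤ k → k ≤ Kb → W * Z ^ 3 * (klTowerMeasWtAt L M β U μ K d k j (2 * 3) / klLevUnitF β M 0 3 (d * k - 1)) ≤ ι₃ * lam ^ 2)
    -- the token along the blocks («(ℓ)-Z-THREAD»): base, and propagation under the step's guard
    (hZ1 : Zk 1)
    (hZsucc : ∀ k, 1 ≤ k → k < Kb → Zk k →
      Φ * towerV D τ (fun m => W * Z ^ m * (klTowerMeasWtAt L M β U μ K d k j (2 * m) / klLevUnitF β M 0 m (d * k - 1))) < 1 → Zk (k + 1))
    -- the weighted step at blocks 1 ≤ k < Kb (W2's LINK), which may use the token at its own block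
    (hstep : ∀ k, 1 ≤ k → k < Kb → Zk k → ∀ N : ℕ, 2 ≤ N → ∀ p, 3 ≤ p → p ≤ D →
      Φ * towerV D τ (fun m => W * Z ^ m * (klTowerMeasWtAt L M β U μ K d k j (2 * m) / klLevUnitF β M 0 m (d * k - 1))) < 1 →
      klTowerBornWtAt L M β U μ K d k j (2 * p) / klLevUnitF β M 0 p (d * k) ≤
        towerFO D σ (fun m => W * Z ^ m * (klTowerMeasWtAt L M β U μ K d k j (2 * m) / klLevUnitF β M 0 m (d * k - 1))) p +
          ∑ n ∈ Icc 2 N, exp 1 * Φ ^ (n - 1) * ψ ^ p *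
            towerS D τ (fun m => W * Z ^ m * (klTowerMeasWtAt L M β U μ K d k j (2 * m) / klLevUnitF β M 0 m (d * k - 1))) n p +
          ψ ^ p * exp 1 * towerV D τ (fun m => W * Z ^ m * (klTowerMeasWtAt L M β U μ K d k j (2 * m) / klLevUnitF β M 0 m (d * k - 1))) *
            (Φ * towerV D τ (fun m => W * Z ^ m * (klTowerMeasWtAt L M β U μ K d k j (2 * m) / klLevUnitF β M 0 m (d * k - 1)))) ^ N /
            (1 - Φ * towerV D τ (fun m => W * Z ^ m * (klTowerMeasWtAt L M β U μ K d k j (2 * m) / klLevUnitF β M 0 m (d * k - 1)))))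
    -- the kit's numerics
    (hx₁ : 4 * σ * lam * Q' < 1) (hx₂ : 2 * lam * τ * Q' ≤ 1) (hx₃ : exp 1 * τ * lam * Q' < 1)
    (hy : Φ * (τ * (ι₁ * lam + ι₂ / (2 * Q') + ι₃ / (4 * Q' ^ 2) + A' * Q' / 4)) < 1)
    (hθ : Φ * (exp 1 * τ * (ι₁ * lam) + (exp 1 * τ) ^ 2 * (ι₂ * lam) + (exp 1 * τ) ^ 3 * (ι₃ * lam ^ 2) +
      A' * (exp 1 * τ * Q') * ((exp 1 * τ * lam * Q') ^ 3 / (1 - exp 1 * τ * lam * Q'))) < 1)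
    (hu₁ : 4 * Q' ≤ Q) (hu₂ : 2 * τ * ψ * Q' ≤ Q)
    (hclose : A' * (4 * Q') ^ 3 * (4 * σ * lam * Q' / (1 - 4 * σ * lam * Q')) +
      exp 1 * ψ * (2 * τ * ψ * Q') ^ 2 * (τ * (ι₁ * lam + ι₂ / (2 * Q') + ι₃ / (4 * Q' ^ 2) + A' * Q' / 4)) *
        (Φ * (τ * (ι₁ * lam + ι₂ / (2 * Q') + ι₃ / (4 * Q' ^ 2) + A' * Q' / 4)) /
          (1 - Φ * (τ * (ι₁ * lam + ι₂ / (2 * Q') + ι₃ / (4 * Q' ^ 2) + A' * Q' / 4)))) ≤ A * Q ^ 3) :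
    (∀ k, 1 ≤ k → k ≤ Kb → Zk k) ∧
    (∀ k, 2 ≤ k → k ≤ Kb → ∀ p : ℕ, 3 ≤ p → p ≤ D →
      klTowerBornWtAt L M β U μ K d (k - 1) j (2 * p) / klLevUnitF β M 0 p (d * (k - 1)) ≤ A * lam ^ (p - 1) * Q ^ p) ∧
    (∀ k, 1 ≤ k → k ≤ Kb → ∀ m, 4 ≤ m → m ≤ D →
      W * Z ^ m * (klTowerMeasWtAt L M β U μ K d k j (2 * m) / klLevUnitF β M 0 m (d * k - 1)) ≤ A' * lam ^ (m - 1) * Q' ^ m) := by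
  -- the inline arrays
  set b : Unit → ℕ → ℕ → ℝ := fun _ k p => klTowerBornWtAt L M β U μ K d (k - 1) j (2 * p) / klLevUnitF β M 0 p (d * (k - 1)) with hb
  set μw : ℕ → ℕ → ℝ := fun k m => W * Z ^ m * (klTowerMeasWtAt L M β U μ K d k j (2 * m) / klLevUnitF β M 0 m (d * k - 1)) with hμw
  have hprof : ∀ k, 1 ≤ k → k < Kb →
      (∀ k', 2 ≤ k' → k' ≤ k → ∀ t : Unit, ∀ p, 3 ≤ p → p ≤ D → b t k' p ≤ A * lam ^ (p - 1) * Q ^ p) →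
      ∀ m, 4 ≤ m → m ≤ D → μw k m ≤ A' * lam ^ (m - 1) * Q' ^ m := by
    intro k hk1 hkK ih m hm hmD
    rcases Nat.lt_or_ge k 2 with hk | hk
    · obtain rfl : k = 1 := by omega
      exact hbase m hm hmD
    · exact hR k hk hkK.le (fun k' hk'2 hk'le p hp hpD => ih k' hk'2 hk'le () p hp hpD) m hm hmD
  have hprof3 : ∀ k, 1 ≤ k → k < Kb → 3 ≤ D →
      (∀ k', 2 ≤ k' → k' ≤ k → ∀ t : Unit, ∀ p, 3 ≤ p → p ≤ D → b t k' p ≤ A * lam ^ (p - 1) * Q ^ p) →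
      μw k 3 ≤ ι₃ * lam ^ 2 :=
    fun k hk1 hkK _ _ => hι₃ k hk1 hkK.le
  have hstep' : ∀ t : Unit, ∀ k, 1 ≤ k → k < Kb → Zk k → ∀ N : ℕ, 2 ≤ N → ∀ p, 3 ≤ p → p ≤ D → Φ * towerV D τ (μw k) < 1 →
      b t (k + 1) p ≤ towerFO D σ (μw k) p + ∑ n ∈ Icc 2 N, exp 1 * Φ ^ (n - 1) * ψ ^ p * towerS D τ (μw k) n p +
        ψ ^ p * exp 1 * towerV D τ (μw k) * (Φ * towerV D τ (μw k)) ^ N / (1 - Φ * towerV D τ (μw k)) := by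
    intro _ k hk1 hkK hZk N hN p hp hpD hguard
    have hbk : b () (k + 1) p = klTowerBornWtAt L M β U μ K d k j (2 * p) / klLevUnitF β M 0 p (d * k) := by
      simp only [hb, Nat.add_sub_cancel]
    rw [hbk]
    exact hstep k hk1 hkK hZk N hN p hp hpD hguard
  obtain ⟨hZall, hlaw⟩ := towerBorn_le_law_tracks_of_profile_base_tok (T := Unit) (K := Kb) (D := D) (b := b) (μ := μw)
    (A := A) (lam := lam) (Q := Q) (A' := A') (Q' := Q') (ι₁ := ι₁) (ι₂ := ι₂) (ι₃ := ι₃) (Zk := Zk) hD3 hlam hA hQ hσ hΦ hψ hτ hQ'0 hA'0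
    (fun k _ m => towerMuWt_nonneg hβ U μ K d k j m hW hZ) hZ1 hZsucc hprof hprof3
    (fun k hk1 hkK => hι₁ k hk1 hkK.le) (fun k hk1 hkK => hι₂ k hk1 hkK.le) hstep' hx₁ hx₂ hx₃ hy hθ hu₁ hu₂ hclose
  refine ⟨hZall, fun k hk2 hkK p hp hpD => hlaw k hk2 hkK () p hp hpD, fun k hk1 hkK m hm hmD => ?_⟩
  rcases Nat.lt_or_ge k 2 with hk | hk
  · obtain rfl : k = 1 := by omega
    exact hbase m hm hmD
  · exact hR k hk hkK (fun k' hk'2 hk'le p hp hpD => hlaw k' hk'2 (hk'le.trans hkK) () p hp hpD) m hm hmD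

end Summit.HubbardSuperconductivity.HubbardSuperconductivity.Theorems.EngineV8

end
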